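import Mathlib.Analysis.InnerProductSpace.Basic
import Mathlib.Analysis.SpecialFunctions.Pow.Real
import HarnessLib

/-!
# The one-mode Bogoliubov diagonalisation `A a*a + (B/2)(aa + a*a*) = D b*b + ½(D - A)`

Topic `Literature/MathematicalPhysics/QuantumManyBody`, namespace `Bogoliubov` (companion of
`BogoliubovSimpleMethod.lean`; provefact
`Literature.MathematicalPhysics.QuantumManyBody.BoseGas.Junge2026_neumannBox_pinnedLowerBound`, whose
printed proof [FournaisEtAl2024, §2.7] diagonalises the quadratic Bogoliubov Hamiltonian on the
Neumann box mode by mode). In the symmetrised Neumann eigenbasis the quadratic part of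
`𝓗_μ(z)` couples each mode `p` only to itself, and [FournaisEtAl2024, (2.37)–(2.38)] is the exact
identity, "using the CCR",
`(τ + ρ_z ĝ) a_p*a_p + (ĝ/(2|Λ|))(z̄² a_pa_p + z² a_p*a_p*) = D_p b_p*b_p + ½(D_p - τ - ρ_zĝ)`,
`D_p = √(τ² + 2τρ_zĝ)`, `b_p = (a_p + α_p a_p*)/√(1-α_p²)`, `α_p = (τ + ρ_zĝ - D_p)/(ρ_zĝ)`
(after absorbing the phase of `z²` into `a_p`, the coefficients are real: `A = τ + ρ_zĝ`,
`B = ρ_zĝ = |z|²ĝ/|Λ|`, `D = √(A² - B²)`).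

We prove it, as in `BogoliubovSimpleMethod.lean`, as an identity of QUADRATIC FORMS on an
arbitrary complex inner-product space `V`: `a : V →ₗ V` with a formal adjoint `c = a*`
(`⟪c x, y⟫ = ⟪x, a y⟫`) satisfying the CCR `a a* = a*a + 1` (`a (c x) = c (a x) + x`), evaluated
at `ψ`: `⟪ψ, a*aψ⟫ = ‖aψ‖²`, `⟪ψ, (aa + a*a*)ψ⟫ = 2Re⟪a*ψ, aψ⟫`, `⟪ψ, b*bψ⟫ = ‖bψ‖²`,
`‖a*ψ‖² = ‖aψ‖² + ‖ψ‖²`: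

* `one_mode_diagonalization` — for real `A, B` with `0 < |B| < A`,
  `A‖aψ‖² + B Re⟪a*ψ, aψ⟫ = D ‖bψ‖² + ½(D - A)‖ψ‖²`, `D = √(A²-B²)`,
  `bψ = (1-α²)^{-1/2}(aψ + α a*ψ)`, `α = (A - D)/B` (so `|α| < 1`, `Bα = A - D`,
  `B(1+α²) = 2Aα`, `1 - α² = 2Dα/B`);
* `one_mode_lower_bound` — hence `A‖aψ‖² + B Re⟪a*ψ, aψ⟫ ≥ -½(A - √(A²-B²))‖ψ‖²`, the
  one-mode case of [LiebSolovej2001, Thm. 6.3] with the exact CCR.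

## References

* [FournaisEtAl2024] S. Fournais, L. Junge, T. Girardot, L. Morin, M. Olivieri, A. Triay, *The free
  energy of dilute Bose gases at low temperatures interacting via strong potentials*,
  arXiv:2408.14222, Ann. Henri Poincaré (2026): §2.7, (2.37)–(2.38).
* [LiebSolovej2001] E. H. Lieb, J. P. Solovej, *Ground state energy of the one-component charged
  Bose gas*, Commun. Math. Phys. 217 (2001) 127–163: Theorem 6.3.
-/

noncomputable section

open ComplexConjugate
open scoped InnerProductSpace

namespace Literature.MathematicalPhysics.QuantumManyBody.Bogoliubov

variable {V : Type*} [NormedAddCommGroup V] [InnerProductSpace ℂ V]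

/-- The CCR in form sense: if `c = a*` formally and `a c = c a + 1`, then `‖a*ψ‖² = ‖aψ‖² + ‖ψ‖²`.
[cite: FournaisEtAl2024, (2.29)] -/
theorem norm_sq_adjoint_of_ccr (a c : V →ₗ[ℂ] V) (hadj : ∀ x y, ⟪c x, y⟫_ℂ = ⟪x, a y⟫_ℂ)
    (hccr : ∀ x, a (c x) = c (a x) + x) (ψ : V) :
    ‖c ψ‖ ^ 2 = ‖a ψ‖ ^ 2 + ‖ψ‖ ^ 2 := by
  have h1 : (⟪c ψ, c ψ⟫_ℂ) = ⟪a ψ, a ψ⟫_ℂ + ⟪ψ, ψ⟫_ℂ := by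
    rw [hadj, hccr, inner_add_right, ← inner_conj_symm ψ (c (a ψ)), hadj, inner_conj_symm]
  have h2 := congrArg Complex.re h1
  simp only [Complex.add_re] at h2
  rw [← @inner_self_eq_norm_sq ℂ, ← @inner_self_eq_norm_sq ℂ, ← @inner_self_eq_norm_sq ℂ]
  exact h2

/-- `‖x + α y‖² = ‖x‖² + 2α Re⟪x, y⟫ + α²‖y‖²` for real `α`. [folklore] -/
theorem norm_add_real_smul_sq (x y : V) (α : ℝ) :
    ‖x + (α : ℂ) • y‖ ^ 2 = ‖x‖ ^ 2 + 2 * α * (⟪x, y⟫_ℂ).re + α ^ 2 * ‖y‖ ^ 2 := by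
  rw [norm_add_sq (𝕜 := ℂ), inner_smul_right, norm_smul, Complex.norm_real, Real.norm_eq_abs,
    mul_pow, sq_abs]
  simp only [RCLike.re_to_complex, Complex.mul_re, Complex.ofReal_re, Complex.ofReal_im, zero_mul,
    sub_zero]
  ring

/-- **FGJMOT (2.37)–(2.38): the one-mode Bogoliubov diagonalisation**, as an identity of
quadratic forms. For `a` with formal adjoint `c = a*` satisfying the CCR `a a* = a*a + 1`, and real
`A, B` with `0 < |B| < A`: with `D = √(A² - B²)`, `α = (A - D)/B`,
`bψ = (1 - α²)^{-1/2}(aψ + α a*ψ)`,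
`A‖aψ‖² + B Re⟪a*ψ, aψ⟫ = D‖bψ‖² + ½(D - A)‖ψ‖²`, i.e.
`⟨ψ, (A a*a + (B/2)(aa + a*a*))ψ⟩ = ⟨ψ, (D b*b + ½(D - A))ψ⟩`. [cite: FournaisEtAl2024, (2.37)–(2.38)] -/
theorem one_mode_diagonalization (a c : V →ₗ[ℂ] V) (hadj : ∀ x y, ⟪c x, y⟫_ℂ = ⟪x, a y⟫_ℂ)
    (hccr : ∀ x, a (c x) = c (a x) + x) {A B : ℝ} (hB : B ≠ 0) (hBA : |B| < A) (ψ : V) :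
    A * ‖a ψ‖ ^ 2 + B * (⟪c ψ, a ψ⟫_ℂ).re =
      Real.sqrt (A ^ 2 - B ^ 2) *
          ‖(((Real.sqrt (1 - ((A - Real.sqrt (A ^ 2 - B ^ 2)) / B) ^ 2))⁻¹ : ℝ) : ℂ) •
              (a ψ + (((A - Real.sqrt (A ^ 2 - B ^ 2)) / B : ℝ) : ℂ) • c ψ)‖ ^ 2 +
        (Real.sqrt (A ^ 2 - B ^ 2) - A) / 2 * ‖ψ‖ ^ 2 := by
  -- the scalars `D = √(A² - B²)`, `α = (A - D)/B`, `1 - α² = 2Dα/B > 0`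
  have hA : 0 < A := (abs_nonneg B).trans_lt hBA
  have hB2 : B ^ 2 < A ^ 2 := by
    have h1 : |B| ^ 2 < A ^ 2 := pow_lt_pow_left₀ hBA (abs_nonneg B) two_ne_zero
    simpa [sq_abs] using h1
  have hB2pos : 0 < B ^ 2 := by positivity
  have hD2 : Real.sqrt (A ^ 2 - B ^ 2) ^ 2 = A ^ 2 - B ^ 2 := Real.sq_sqrt (by linarith)
  have hD0 : 0 < Real.sqrt (A ^ 2 - B ^ 2) := Real.sqrt_pos.2 (by linarith)
  generalize Real.sqrt (A ^ 2 - B ^ 2) = D at hD2 hD0 ⊢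
  have hDA : D < A := lt_of_pow_lt_pow_left₀ 2 hA.le (by nlinarith)
  have hBα' : B * ((A - D) / B) = A - D := by field_simp
  generalize (A - D) / B = α at hBα' ⊢
  have hBα : B * α = A - D := hBα'
  have hα0 : α ≠ 0 := by
    intro h; rw [h, mul_zero] at hBα; linarith
  have hquad : B * (1 + α ^ 2) = 2 * A * α := by
    have h : B * (B * (1 + α ^ 2)) = B * (2 * A * α) := by
      have e1 : B * (B * (1 + α ^ 2)) = B ^ 2 + (B * α) ^ 2 := by ring
      have e2 : B * (2 * A * α) = 2 * A * (B * α) := by ring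
      rw [e1, e2, hBα]
      linear_combination hD2
    exact mul_left_cancel₀ hB h
  have hκ : 1 - α ^ 2 = 2 * D * α / B := by
    have h : B * (B * (1 - α ^ 2)) = B * (B * (2 * D * α / B)) := by
      have e1 : B * (B * (1 - α ^ 2)) = B ^ 2 - (B * α) ^ 2 := by ring
      have e2 : B * (B * (2 * D * α / B)) = 2 * D * (B * α) := by field_simp
      rw [e1, e2, hBα]
      linear_combination hD2
    exact mul_left_cancel₀ hB (mul_left_cancel₀ hB h)
  have hκ0 : 0 < 1 - α ^ 2 := by
    have h2 : B ^ 2 * (1 - α ^ 2) = 2 * D * (A - D) := by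
      rw [hκ, ← hBα]; field_simp
    have h3 : 0 < B ^ 2 * (1 - α ^ 2) := by
      rw [h2]; nlinarith [mul_pos hD0 (sub_pos.2 hDA)]
    exact pos_of_mul_pos_right h3 hB2pos.le
  -- the three coefficient identities for `k = (1 - α²)⁻¹ = B/(2Dα)`
  have hD0' : D ≠ 0 := hD0.ne'
  have e1 : D * (1 - α ^ 2)⁻¹ * (1 + α ^ 2) = A := by
    rw [hκ]; field_simp; linear_combination hquad
  have e2 : D * (1 - α ^ 2)⁻¹ * (2 * α) = B := by
    rw [hκ]; field_simp
  have e3 : D * (1 - α ^ 2)⁻¹ * α ^ 2 = (A - D) / 2 := by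
    rw [hκ]; field_simp; linear_combination hBα
  -- the quadratic forms
  have hy : ‖c ψ‖ ^ 2 = ‖a ψ‖ ^ 2 + ‖ψ‖ ^ 2 := norm_sq_adjoint_of_ccr a c hadj hccr ψ
  have hre : (⟪c ψ, a ψ⟫_ℂ).re = (⟪a ψ, c ψ⟫_ℂ).re := by
    rw [← inner_conj_symm, Complex.conj_re]
  have hnorm : ‖(((Real.sqrt (1 - α ^ 2))⁻¹ : ℝ) : ℂ) • (a ψ + (α : ℂ) • c ψ)‖ ^ 2 =
      (1 - α ^ 2)⁻¹ * (‖a ψ‖ ^ 2 + 2 * α * (⟪a ψ, c ψ⟫_ℂ).re + α ^ 2 * ‖c ψ‖ ^ 2) := by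
    rw [norm_smul, mul_pow, Complex.norm_real, Real.norm_eq_abs, sq_abs, inv_pow,
      Real.sq_sqrt hκ0.le, norm_add_real_smul_sq]
  rw [hnorm, hy, hre]
  linear_combination (-‖a ψ‖ ^ 2) * e1 + (-(⟪a ψ, c ψ⟫_ℂ).re) * e2 + (-‖ψ‖ ^ 2) * e3

/-- **The one-mode Bogoliubov lower bound** (the case `b_k = b_{-k}` of [LiebSolovej2001,
Thm. 6.3], with the exact CCR): for `a` with formal adjoint `a*` and `a a* = a*a + 1`, and real
`A, B` with `0 < |B| < A`, `A‖aψ‖² + B Re⟪a*ψ, aψ⟫ ≥ -½(A - √(A² - B²))‖ψ‖²`, i.e.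
`A a*a + (B/2)(aa + a*a*) ≥ -½(A - √(A²-B²))` — from the diagonalisation, `D b*b ≥ 0`.
[cite: FournaisEtAl2024, (2.37)–(2.38)] [cite: LiebSolovej2001, Thm. 6.3] -/
theorem one_mode_lower_bound (a c : V →ₗ[ℂ] V) (hadj : ∀ x y, ⟪c x, y⟫_ℂ = ⟪x, a y⟫_ℂ)
    (hccr : ∀ x, a (c x) = c (a x) + x) {A B : ℝ} (hB : B ≠ 0) (hBA : |B| < A) (ψ : V) :
    -(1 / 2 * (A - Real.sqrt (A ^ 2 - B ^ 2))) * ‖ψ‖ ^ 2 ≤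
      A * ‖a ψ‖ ^ 2 + B * (⟪c ψ, a ψ⟫_ℂ).re := by
  rw [one_mode_diagonalization a c hadj hccr hB hBA ψ]
  have hD0 : 0 ≤ Real.sqrt (A ^ 2 - B ^ 2) := Real.sqrt_nonneg _
  nlinarith [mul_nonneg hD0 (sq_nonneg
    ‖(((Real.sqrt (1 - ((A - Real.sqrt (A ^ 2 - B ^ 2)) / B) ^ 2))⁻¹ : ℝ) : ℂ) •
        (a ψ + (((A - Real.sqrt (A ^ 2 - B ^ 2)) / B : ℝ) : ℂ) • c ψ)‖)]

end Literature.MathematicalPhysics.QuantumManyBody.Bogoliubov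

end
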